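import Literature.Probability.Percolation.TriQuadProtection
import Literature.Probability.Percolation.TriQuadStagesBK
import HarnessLib

/-!
# Separation of the tips of the canonical open and closed crossings on the good event

Topic `Literature/Probability/Percolation`; family `crit-perc`, statement **crit-perc.S16**
(`Literature.Probability.Percolation.triTheta_exponent`). The deterministic conclusion of the
protection step of Kesten's arm separation (P. Nolin, EJP 13 (2008), §4.4, proof of Lemma 15
[arXiv 0711.4948: Lemma 14]: "the white circuit prevent[s] other disjoint black crossings to
arrive near `z_u` … the extremities of these two new crossings are η-separated from the two
extremities of the `t - 2` other curves") for an abstract lattice quad `Q` and the two-colour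
stage construction of `TriQuadStages.lean`:

* `TriQuad.canonSupport_subset_explored_of_meets` — a canonical crossing of one colour that
  meets the explored set of the other colour at the same stage lies inside it (below the other
  colour's lowest crossing).
* `TriQuad.not_both_below` — the canonical open and closed crossings of the same stage cannot
  each lie in the other's explored set (`low_dichotomy` + `explored_subset_low`).
* `TriQuad.tips_far_of_prot` — **on the protection events, the tips are far apart**: if stage
  `u_o` carries an open canonical crossing with tip `l_o`, stage `u_c` a closed one with tip `l_c`
  (i.e. open for `ωᶜ`), the open tip is protected (`ProtO K M₀ ω u_o`), the closed tip is
  protected (`ProtO K M₀ ωᶜ u_c`), and the far boundary `R` lies outside the `2 · 3^{K-1} M₀`-boxes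
  about the points of `L`, then `l_o` and `l_c` are at sup-distance `> M₀`. Four cases:
  `u_o < u_c` (the closed crossing avoids `openStop ω u_o`, and is blocked by the forced-open frame
  about `l_o`), `u_c < u_o` (symmetric), and `u_o = u_c` where one of the two crossings avoids the
  other's explored set unless both lie below each other, which `not_both_below` excludes.

## References

* P. Nolin, Near-critical percolation in two dimensions, *Electron. J. Probab.* 13 (2008), §4.4,
  proof of Lemma 15 [arXiv 0711.4948: Lemma 14] [Nolin2008].
* H. Kesten, Scaling relations for 2D-percolation, *Comm. Math. Phys.* 109 (1987), Lemma 2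
  [KestenScalingCMP1987].

## Mathlib / tree

Tree: `TriQuad.ProtO`, `not_pathIn_closed_of_protO`, `openStop`, `openStop_subset_stages_succ`,
`canonSet`, `canonStart`, `canonSupport`, `canonSupport_spec`, `exists_crossing_canonSet`,
`hasCanon_of_pathIn` (`TriQuadProtection.lean`), `TriQuad.stages_mono`, `stages_compl`
(`TriQuadStages.lean`), `TriQuad.explored`, `mem_explored`, `botCluster`, `botCluster_subset_explored`,
`explored_subset_low`, `low_dichotomy` (`TriLowestCrossingSwitch.lean`).
-/

noncomputable section

open Set

namespace Literature.Probability.Percolation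

open LatticeModels

namespace TriQuad

variable {Q : TriQuad}

/-! ### Crossings inside the other colour's explored set -/

/-- A closed site of the explored set lies in the closed cluster of the bottom part. [folklore] -/
theorem mem_botCluster_of_mem_explored {ξ : Set (Site 2)} {v : Site 2} (hv : v ∈ Q.explored ξ) (hvξ : v ∉ ξ) :
    v ∈ Q.botCluster ξ := by
  obtain ⟨hvU, hvB | ⟨w, hw, hwv⟩⟩ := mem_explored.1 hv
  · exact ⟨v, hvB, PathIn.refl ⟨Finset.mem_coe.2 hvU, hvξ⟩⟩
  · rcases hwv with rfl | hwv
    · exact hw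
    · obtain ⟨b, hb, hp⟩ := hw
      exact ⟨b, hb, hp.tail hwv ⟨Finset.mem_coe.2 hvU, hvξ⟩⟩

/-- A `𝕋`-connected set of closed sites of `U` meeting the closed cluster lies inside it. [folklore] -/
theorem subset_botCluster_of_meets {ξ S : Set (Site 2)} (hS : S ⊆ ↑Q.U ∩ ξᶜ) {x : Site 2}
    (hall : ∀ z ∈ S, PathIn triGraph S x z) {v : Site 2} (hvS : v ∈ S) (hv : v ∈ Q.botCluster ξ) :
    S ⊆ Q.botCluster ξ := by
  intro z hz
  obtain ⟨b, hb, hp⟩ := hv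
  exact ⟨b, hb, hp.trans (((hall v hvS).symm.trans (hall z hz)).mono hS)⟩

/-- **A canonical crossing of one colour meeting the other colour's explored set lies inside
it.** With `N = N_u`: if the tight support `S ⊆ U ∩ (ξᶜ \ N)` (a crossing by `ξ`-closed sites
avoiding `N`) meets `explored (ξ \ N)`, then `S ⊆ explored (ξ \ N)`. [cite: Nolin2008, §4.4, proof of Lemma 15 (arXiv 0711.4948: Lemma 14)] -/
theorem subset_explored_of_meets {ξ : Set (Site 2)} {N : Finset (Site 2)} {S : Set (Site 2)}
    (hS : S ⊆ ↑Q.U ∩ (ξᶜ \ ↑N)) {x : Site 2} (hall : ∀ z ∈ S, PathIn triGraph S x z) {v : Site 2} (hvS : v ∈ S)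
    (hv : v ∈ Q.explored (ξ \ ↑N)) : S ⊆ ↑(Q.explored (ξ \ ↑N)) := by
  have hS' : S ⊆ ↑Q.U ∩ (ξ \ ↑N)ᶜ := fun z hz => ⟨(hS hz).1, fun h => (hS hz).2.1 h.1⟩
  have hvK : v ∈ Q.botCluster (ξ \ ↑N) := mem_botCluster_of_mem_explored hv fun h => (hS hvS).2.1 h.1
  intro z hz
  exact botCluster_subset_explored (subset_botCluster_of_meets hS' hall hvS hvK hz)

/-- **The canonical open and closed crossings of a stage are not both below each other**: tight
supports `S_o ⊆ U ∩ (ω \ N)` and `S_c ⊆ U ∩ (ωᶜ \ N)` of `L–R` crossings cannot satisfy both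
`S_c ⊆ explored (ω \ N)` and `S_o ⊆ explored (ωᶜ \ N)` (by `low_dichotomy`, one of them has no
site joined to `B` off the other, while `explored_subset_low` joins every site of an explored set
to `B` off any crossing it avoids). [cite: Nolin2008, §4.4, proof of Lemma 15 (arXiv 0711.4948: Lemma 14)] -/
theorem not_both_below {ω : Set (Site 2)} {N : Finset (Site 2)} {So Sc : Set (Site 2)}
    (hSo : So ⊆ ↑Q.U ∩ (ω \ ↑N)) (hSc : Sc ⊆ ↑Q.U ∩ (ωᶜ \ ↑N))
    {xo yo : Site 2} (hxo : xo ∈ Q.L) (hyo : yo ∈ Q.R) (hpo : PathIn triGraph So xo yo)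
    (hallo : ∀ z ∈ So, PathIn triGraph So xo z)
    {xc yc : Site 2} (hxc : xc ∈ Q.L) (hyc : yc ∈ Q.R) (hpc : PathIn triGraph Sc xc yc)
    (hallc : ∀ z ∈ Sc, PathIn triGraph Sc xc z)
    (hco : Sc ⊆ ↑(Q.explored (ω \ ↑N))) (hoc : So ⊆ ↑(Q.explored (ωᶜ \ ↑N))) : False := by
  have hdisj : Disjoint So Sc := Set.disjoint_left.2 fun z hzo hzc => (hSc hzc).2.1 (hSo hzo).2.1
  rcases low_dichotomy (fun z hz => (hSo hz).1) (fun z hz => (hSc hz).1) hdisj hxo hyo hpo hallo hxc hyc hpc hallc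
    with h | h
  · -- no site of `Sc` is joined to `B` off `So`: but `xc ∈ Sc ⊆ explored (ω \ N)` is
    have hx := hpc.left_mem
    rcases explored_subset_low hSo (Finset.mem_coe.1 (hco hx)) with h' | h'
    · exact Set.disjoint_left.1 hdisj h' hx
    · exact h xc hx h'
  · have hx := hpo.left_mem
    have hSc'' : Sc ⊆ ↑Q.U ∩ (ωᶜ \ ↑N) := hSc
    rcases explored_subset_low hSc'' (Finset.mem_coe.1 (hoc hx)) with h' | h'
    · exact Set.disjoint_left.1 hdisj hx h'
    · exact h xo hx h'

/-! ### The tips are far apart -/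

/-- Sup-distance boxes: `InBox c r v` means `‖v - c‖_∞ ≤ r`. [folklore] -/
def InBox (c : Site 2) (r : ℤ) (v : Site 2) : Prop :=
  c 0 - r ≤ v 0 ∧ v 0 ≤ c 0 + r ∧ c 1 - r ≤ v 1 ∧ v 1 ≤ c 1 + r

/-- **On the protection events the open and closed tips are far apart.** Let stage `u_o` carry an
open crossing avoiding `N_{u_o}` and stage `u_c` a closed one (an open crossing of `ωᶜ` avoiding
`N_{u_c}`), both before the construction stops; let the open tip be protected in `ω` and the
closed tip in `ωᶜ` (`ProtO K M₀`, `M₀ ≥ 1`), and let every site of `R` lie outside the open box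
of radius `2 · 3^i M₀` about every site of `L`, for every `i < K` (`hfar`: the far boundary is far
from the inner arc). Then the closed tip is not in the `M₀`-box about the open tip. [cite: Nolin2008, §4.4, proof of Lemma 15 ("the extremities … are η-separated"; arXiv 0711.4948: Lemma 14)] -/
theorem tips_far_of_prot {K M₀ : ℕ} (hM₀ : 1 ≤ M₀) {ω : Set (Site 2)} {uo uc : ℕ}
    (ho : Q.LRPath (ω \ ↑(Q.stages ω uo))) (hc : Q.LRPath (ωᶜ \ ↑(Q.stages ω uc)))
    (hPo : Q.ProtO K M₀ ω uo) (hPc : Q.ProtO K M₀ ωᶜ uc)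
    (hfar : ∀ l ∈ Q.L, ∀ y ∈ Q.R, ∀ i < K,
      y 0 ≤ l 0 - 2 * ((3 ^ i * M₀ : ℕ) : ℤ) ∨ l 0 + 2 * ((3 ^ i * M₀ : ℕ) : ℤ) ≤ y 0 ∨
        y 1 ≤ l 1 - 2 * ((3 ^ i * M₀ : ℕ) : ℤ) ∨ l 1 + 2 * ((3 ^ i * M₀ : ℕ) : ℤ) ≤ y 1) :
    ¬ InBox (Q.canonStart (Q.canonSet ω uo)) M₀ (Q.canonStart (Q.canonSet ωᶜ uc)) := by
  classical
  -- the two canonical crossings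
  obtain ⟨xo, hxo, yo', hyo', hpo'⟩ := exists_crossing_canonSet ho
  have hcano : Q.HasCanon (Q.canonSet ω uo) := hasCanon_of_pathIn hxo hyo' hpo'
  obtain ⟨hloL, hSo, ⟨yo, hyo, hpo⟩, hallo, -⟩ := canonSupport_spec hcano
  have hc' : Q.LRPath (ωᶜ \ ↑(Q.stages ωᶜ uc)) := by rwa [stages_compl]
  obtain ⟨xc, hxc, yc', hyc', hpc'⟩ := exists_crossing_canonSet hc'
  have hcanc : Q.HasCanon (Q.canonSet ωᶜ uc) := hasCanon_of_pathIn hxc hyc' hpc'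
  obtain ⟨hlcL, hSc, ⟨yc, hyc, hpc⟩, hallc, -⟩ := canonSupport_spec hcanc
  have hSo' : (Q.canonSupport (Q.canonSet ω uo)) ⊆ ↑Q.U ∩ (ω \ ↑(Q.stages ω uo)) := fun z hz => (hSo hz).1
  have hSc' : (Q.canonSupport (Q.canonSet ωᶜ uc)) ⊆ ↑Q.U ∩ (ωᶜ \ ↑(Q.stages ω uc)) := fun z hz => by
    have := (hSc hz).1; rwa [stages_compl] at this
  have hSoE : (Q.canonSupport (Q.canonSet ω uo)) ⊆ ↑(Q.explored (ω \ ↑(Q.stages ω uo))) := fun z hz => (hSo hz).2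
  have hScE : (Q.canonSupport (Q.canonSet ωᶜ uc)) ⊆ ↑(Q.explored (ωᶜ \ ↑(Q.stages ω uc))) := fun z hz => by
    have := (hSc hz).2; rwa [stages_compl] at this
  intro hbox
  have hM₀' : (1 : ℤ) ≤ M₀ := by exact_mod_cast hM₀
  have scale_ge : ∀ i : ℕ, (M₀ : ℤ) ≤ ((3 ^ i * M₀ : ℕ) : ℤ) := fun i => by
    have : M₀ ≤ 3 ^ i * M₀ := Nat.le_mul_of_pos_left M₀ (by positivity)
    exact_mod_cast this
  -- blocking by the open tip's protection: a closed crossing avoiding `openStop ω uo` cannot start in the box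
  have blockO : Disjoint (Q.canonSupport (Q.canonSet ωᶜ uc)) ↑(Q.openStop ω uo) → False := by
    intro hd
    obtain ⟨i, hi, hblock⟩ := not_pathIn_closed_of_protO hM₀ hPo
    refine hblock (A := (Q.canonSupport (Q.canonSet ωᶜ uc))) (s := (Q.canonStart (Q.canonSet ωᶜ uc))) (t := yc) (fun z hz => ⟨⟨(hSc' hz).1, (hSc' hz).2.1⟩, ?_⟩) ?_
      (hfar (Q.canonStart (Q.canonSet ω uo)) hloL yc hyc i hi) hpc
    · exact fun h => Set.disjoint_left.1 hd hz h
    · have := scale_ge i; unfold InBox at hbox; omega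
  -- blocking by the closed tip's protection (in `ωᶜ`)
  have blockC : Disjoint (Q.canonSupport (Q.canonSet ω uo)) ↑(Q.openStop ωᶜ uc) → False := by
    intro hd
    obtain ⟨i, hi, hblock⟩ := not_pathIn_closed_of_protO hM₀ hPc
    refine hblock (A := (Q.canonSupport (Q.canonSet ω uo))) (s := (Q.canonStart (Q.canonSet ω uo))) (t := yo) (fun z hz => ⟨⟨(hSo' hz).1, ?_⟩, ?_⟩) ?_
      (hfar (Q.canonStart (Q.canonSet ωᶜ uc)) hlcL yo hyo i hi) hpo
    · simpa using (hSo' hz).2.1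
    · exact fun h => Set.disjoint_left.1 hd hz h
    · have := scale_ge i; unfold InBox at hbox; omega
  -- the four cases
  rcases lt_trichotomy uo uc with hlt | heq | hgt
  · -- `uo < uc`: `(Q.canonSupport (Q.canonSet ωᶜ uc))` avoids `N_{uc} ⊇ openStop ω uo`
    refine blockO (Set.disjoint_left.2 fun z hz hzP => (hSc' hz).2.2 ?_)
    exact Finset.mem_coe.2 (stages_mono ω (Nat.succ_le_of_lt hlt) (openStop_subset_stages_succ ω uo (Finset.mem_coe.1 hzP)))
  · -- same stage
    subst heq
    by_cases hdo : Disjoint (Q.canonSupport (Q.canonSet ωᶜ uo)) ↑(Q.openStop ω uo)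
    · exact blockO hdo
    by_cases hdc : Disjoint (Q.canonSupport (Q.canonSet ω uo)) ↑(Q.openStop ωᶜ uo)
    · exact blockC hdc
    -- both crossings meet the other colour's examined set: both lie below each other
    rw [Set.not_disjoint_iff] at hdo hdc
    obtain ⟨v, hvSc, hvP⟩ := hdo
    obtain ⟨w, hwSo, hwP⟩ := hdc
    have hvE : v ∈ Q.explored (ω \ ↑(Q.stages ω uo)) := by
      rcases Finset.mem_union.1 (Finset.mem_coe.1 hvP) with h | h
      · exact absurd (Finset.mem_coe.2 h) (hSc' hvSc).2.2
      · exact h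
    have hwE : w ∈ Q.explored (ωᶜ \ ↑(Q.stages ω uo)) := by
      rcases Finset.mem_union.1 (Finset.mem_coe.1 hwP) with h | h
      · rw [stages_compl] at h
        exact absurd (Finset.mem_coe.2 h) (hSo' hwSo).2.2
      · rwa [stages_compl] at h
    have hco : (Q.canonSupport (Q.canonSet ωᶜ uo)) ⊆ ↑(Q.explored (ω \ ↑(Q.stages ω uo))) :=
      subset_explored_of_meets (ξ := ω) hSc' hallc hvSc hvE
    have hoc : (Q.canonSupport (Q.canonSet ω uo)) ⊆ ↑(Q.explored (ωᶜ \ ↑(Q.stages ω uo))) := by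
      have hSo'' : (Q.canonSupport (Q.canonSet ω uo)) ⊆ ↑Q.U ∩ ((ωᶜ)ᶜ \ ↑(Q.stages ω uo)) := by simpa using hSo'
      exact subset_explored_of_meets (ξ := ωᶜ) hSo'' hallo hwSo hwE
    exact not_both_below hSo' hSc' hloL hyo hpo hallo hlcL hyc hpc hallc hco hoc
  · -- `uc < uo`: `(Q.canonSupport (Q.canonSet ω uo))` avoids `N_{uo} ⊇ openStop ωᶜ uc`
    refine blockC (Set.disjoint_left.2 fun z hz hzP => (hSo' hz).2.2 ?_)
    have h1 := openStop_subset_stages_succ ωᶜ uc (Finset.mem_coe.1 hzP)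
    rw [stages_compl] at h1
    exact Finset.mem_coe.2 (stages_mono ω (Nat.succ_le_of_lt hgt) h1)

end TriQuad

end Literature.Probability.Percolation
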